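import Literature.Computability.AlgebraicComplexity.DIP20MonomialCounts
import HarnessLib

/-!
# Dörfler–Ikenmeyer–Panova 2019, §4: the monomial counts `c_ν(d,n)` stabilise in `d`

Topic `Literature/Computability/AlgebraicComplexity`; sibling proofs file (D-0014) of
`DIP20MultiplicityObstructions.lean` (definition `dipMonomialCount` = DIP's `c_ν(d,n)` of (4.3)). No new
facts, no new definitions.

J. Dörfler, C. Ikenmeyer, G. Panova, SIAM J. Appl. Algebra Geom. 4 (2020) = arXiv:1901.04576, §4
(arXiv pp. 9–10): `c_ν(d,n)` counts the multisets of `d` weak compositions of `n` with vector sum `ν`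
(eq. (4.3)); in the proof of Prop. 4.5 only the compositions with a nonzero entry beyond the first row
matter ("the only `α^i` involved are of the form …", p. 10). Made quantitative: **adding one copy of the
composition `(n, 0, …, 0)` is a bijection** from the multisets counted by `c_ν(d,n)` onto those counted
by `c_{ν + (n,0,…,0)}(d+1,n)` as soon as the tail `|ν| - ν₀ ≤ d` (pigeonhole: among `d+1` compositions
whose entries beyond the first row sum to `≤ d` in total, one is `(n,0,…,0)`):
`dipMonomialCount_add_single_succ` and its three-row form `dipMonomialCount_row_stable_succ`
(`c_{(L+n,y,z)}(d+1,n) = c_{(L,y,z)}(d,n)` for `y + z ≤ d`); dually, **adding `1` to the first entry of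
every composition** is a bijection onto the multisets counted by `c_{ν + (d,0,…,0)}(d, n+1)` when
`|ν| - ν₀ ≤ n` (no composition of the target can start with `0`): `dipMonomialCount_add_single_right_succ`,
three rows `dipMonomialCount_row_stable_right_succ` (`c_{(L+d,y,z)}(d,n+1) = c_{(L,y,z)}(d,n)` for
`y + z ≤ n`). Iterated, **clamping** (`dipMonomialCount_cons_clamp`, any number of rows): `c_{(dn-|τ|, τ)}(d,n) =
c_{(d'n'-|τ|, τ)}(d',n')` with `d' = min d T`, `n' = min n T` for every `T ≥ |τ|`. This is the
stabilisation behind the finite verification of the tails of Lemmas 3.7 / 3.13 via (4.4) (each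
`c_{(L,y,z)}(d,n)` with `y + z ≤ d, n` is a bipartite partition number); `dip44_sum_cons_clamp` clamps
the whole alternating sum of (4.4) at once (any number of rows, termwise under the guards), so that
`a_{(dn-|τ|, τ)}(d[n])` becomes a closed evaluation at `(min d T, min n T)` once (4.4) is applied.

HONEST FRAMING: elementary multiset combinatorics of the toy model's §4; nothing here bears on permanent
versus determinant; VP ≠ VNP is not proved.

## References

* J. Dörfler, C. Ikenmeyer, G. Panova, SIAM J. Appl. Algebra Geom. 4 (2020) = arXiv:1901.04576, §4,
  eq. (4.3) and the proof of Prop. 4.5 (arXiv pp. 9–10). [DorflerIkenmeyerPanova2020]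

## Mathlib and tree

Mathlib: `Multiset.cons_erase`, `Multiset.erase_cons_head`, `Multiset.sum_le_card_nsmul`,
`Multiset.le_sum_of_mem`, `tsub_add_cancel_of_le` (pointwise), `Pi.single`, `Fin.sum_univ_succ`. Tree: `dipMonomialCount` (`DIP20MultiplicityObstructions`).

Provenance: val-lit cell, typer val-lit-t07 g2 (DAG row DIP2020-A; infrastructure for the Lemma 3.7 /
3.13 tail route recorded in HOME/HANDOFF.md § val-lit-t07 and § val-lit-p6).
-/

noncomputable section

namespace Literature.Computability.AlgebraicComplexity

section Stabilisation

variable {ℓ : ℕ}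

/-- Coordinates of a multiset sum of vectors. [folklore] -/
private theorem multiset_sum_apply' (M : Multiset (Fin (ℓ + 1) → ℕ)) (i : Fin (ℓ + 1)) :
    M.sum i = (M.map fun α => α i).sum :=
  (Pi.evalAddMonoidHom (fun _ : Fin (ℓ + 1) => ℕ) i).map_multiset_sum M

/-- A weak composition of `n` whose first entry is `n` is `(n, 0, …, 0)`. [folklore] -/
private theorem eq_single_of_apply_zero_eq {n : ℕ} {α : Fin (ℓ + 1) → ℕ} (hsum : ∑ i, α i = n)
    (h0 : α 0 = n) : α = Pi.single 0 n := by
  rw [Fin.sum_univ_succ, h0] at hsum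
  have hrest' : ∑ i : Fin ℓ, α i.succ = 0 := by omega
  have hrest : ∀ i : Fin ℓ, α i.succ = 0 := fun i =>
    Finset.sum_eq_zero_iff.mp hrest' i (Finset.mem_univ i)
  funext i
  refine Fin.cases ?_ (fun j => ?_) i
  · rw [h0, Pi.single_eq_same]
  · rw [hrest j, Pi.single_eq_of_ne (Fin.succ_ne_zero j)]

/-- **Pigeonhole**: a multiset of `d+1` weak compositions of `n ≥ 1` with vector sum `ν + (n,0,…,0)`,
where the tail `|ν| - ν₀ ≤ d`, contains the composition `(n,0,…,0)`.
[cite: DorflerIkenmeyerPanova2020, §4 (proof of Prop. 4.5, arXiv p. 10)] -/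
private theorem single_mem_of_sum_eq {ν : Fin (ℓ + 1) → ℕ} {d n : ℕ} (hn : 1 ≤ n)
    (hν : ∑ i, ν i = d * n) (ht : d * n ≤ ν 0 + d) {M : Multiset (Fin (ℓ + 1) → ℕ)}
    (hM : Multiset.card M = d + 1 ∧ (∀ α ∈ M, ∑ i, α i = n) ∧ M.sum = ν + Pi.single 0 n) :
    Pi.single 0 n ∈ M := by
  by_contra hmem
  obtain ⟨m, rfl⟩ : ∃ m, n = m + 1 := ⟨n - 1, by omega⟩
  -- every composition in `M` has first entry `≤ m`
  have hle : ∀ a ∈ M.map (fun α => α 0), a ≤ m := by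
    intro a ha
    obtain ⟨α, hα, rfl⟩ := Multiset.mem_map.mp ha
    have hαsum := hM.2.1 α hα
    have hα0 : α 0 ≤ m + 1 := by
      rw [Fin.sum_univ_succ] at hαsum
      omega
    rcases Nat.lt_or_ge (α 0) (m + 1) with hlt | hge
    · omega
    · exact absurd (eq_single_of_apply_zero_eq hαsum (le_antisymm hα0 hge) ▸ hα) hmem
  have hsum0 : (M.map fun α => α 0).sum = ν 0 + (m + 1) := by
    rw [← multiset_sum_apply', hM.2.2, Pi.add_apply, Pi.single_eq_same]
  have hbound := Multiset.sum_le_card_nsmul (M.map fun α => α 0) m hle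
  rw [hsum0, Multiset.card_map, hM.1, smul_eq_mul] at hbound
  have hdm : d * (m + 1) = d * m + d := by ring
  have hdm' : (d + 1) * m = d * m + m := by ring
  rw [hdm] at ht
  rw [hdm'] at hbound
  omega

/-- **`c_ν(d,n)` stabilises in `d`**: for `n ≥ 1` and a weight `ν` of `d·n` with tail `|ν| - ν₀ ≤ d`,
`c_{ν + (n,0,…,0)}(d+1, n) = c_ν(d, n)` — adding one copy of the composition `(n,0,…,0)` is a bijection
between the two families of multisets (its inverse removes one copy, which exists by pigeonhole).
[cite: DorflerIkenmeyerPanova2020, §4, eq. (4.3) and proof of Prop. 4.5 (arXiv pp. 9–10)] -/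
theorem dipMonomialCount_add_single_succ (ν : Fin (ℓ + 1) → ℕ) {d n : ℕ} (hn : 1 ≤ n)
    (hν : ∑ i, ν i = d * n) (ht : d * n ≤ ν 0 + d) :
    dipMonomialCount (ν + Pi.single 0 n) (d + 1) n = dipMonomialCount ν d n := by
  classical
  unfold dipMonomialCount
  have hsn : ∑ i, (Pi.single (0 : Fin (ℓ + 1)) n : Fin (ℓ + 1) → ℕ) i = n := by
    rw [Finset.sum_eq_single (0 : Fin (ℓ + 1)) (fun i _ hi => Pi.single_eq_of_ne hi _)
      (fun h => absurd (Finset.mem_univ _) h), Pi.single_eq_same]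
  exact Nat.card_congr
    { toFun := fun M => ⟨M.1.erase (Pi.single 0 n), by
        have hmem := single_mem_of_sum_eq hn hν ht M.2
        refine ⟨by rw [Multiset.card_erase_of_mem hmem, M.2.1]; rfl,
          fun α hα => M.2.2.1 α (Multiset.mem_of_mem_erase hα), ?_⟩
        have h := Multiset.sum_erase hmem
        rw [M.2.2.2] at h
        exact add_left_cancel (h.trans (add_comm _ _))⟩
      invFun := fun M => ⟨Pi.single 0 n ::ₘ M.1, by
        refine ⟨by rw [Multiset.card_cons, M.2.1], fun α hα => ?_, by
          rw [Multiset.sum_cons, M.2.2.2]; exact add_comm _ _⟩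
        rcases Multiset.mem_cons.mp hα with rfl | h
        · exact hsn
        · exact M.2.2.1 α h⟩
      left_inv := fun M => Subtype.ext (Multiset.cons_erase (single_mem_of_sum_eq hn hν ht M.2))
      right_inv := fun M => Subtype.ext (Multiset.erase_cons_head _ _) }

/-- **Three rows**: `c_{(L+n, y, z)}(d+1, n) = c_{(L, y, z)}(d, n)` for `n ≥ 1`, `L + y + z = dn` and
`y + z ≤ d` (so, iterating, `c_{(L,y,z)}(d,n)` does not depend on `d ≥ y + z`).
[cite: DorflerIkenmeyerPanova2020, §4, eq. (4.3) and proof of Prop. 4.5 (arXiv pp. 9–10)] -/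
theorem dipMonomialCount_row_stable_succ {n d L y z : ℕ} (hn : 1 ≤ n) (hL : L + y + z = d * n)
    (hyz : y + z ≤ d) :
    dipMonomialCount ![L + n, y, z] (d + 1) n = dipMonomialCount ![L, y, z] d n := by
  have hv : (![L + n, y, z] : Fin 3 → ℕ) = ![L, y, z] + Pi.single 0 n := by
    funext i
    fin_cases i
    · simp
    · simp [Pi.single_eq_of_ne]
    · simp [Pi.single_eq_of_ne]
  rw [hv]
  exact dipMonomialCount_add_single_succ ![L, y, z] hn (by simp [Fin.sum_univ_three]; omega)
    (by simp; omega)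

/-- **No composition starts with `0`** when the tail is short: in a multiset of `d` weak compositions
of `n+1` with vector sum `ν + (d,0,…,0)`, where `|ν| = dn` and `|ν| - ν₀ ≤ n`, every composition has a
positive first entry. [cite: DorflerIkenmeyerPanova2020, §4 (proof of Prop. 4.5, arXiv p. 10)] -/
private theorem apply_zero_pos_of_mem {ν : Fin (ℓ + 1) → ℕ} {d n : ℕ} (hν : ∑ i, ν i = d * n)
    (ht : d * n ≤ ν 0 + n) {M : Multiset (Fin (ℓ + 1) → ℕ)}
    (hM : Multiset.card M = d ∧ (∀ α ∈ M, ∑ i, α i = n + 1) ∧ M.sum = ν + Pi.single 0 d)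
    {α : Fin (ℓ + 1) → ℕ} (hα : α ∈ M) : 1 ≤ α 0 := by
  rw [Nat.one_le_iff_ne_zero]
  intro hα0
  have hαsum := hM.2.1 α hα
  rw [Fin.sum_univ_succ, hα0, zero_add] at hαsum
  have hle : α ≤ M.sum := Multiset.le_sum_of_mem hα
  have htail : ∑ j : Fin ℓ, α j.succ ≤ ∑ j : Fin ℓ, ν j.succ :=
    Finset.sum_le_sum fun j _ => by
      have := hle j.succ
      rw [hM.2.2, Pi.add_apply, Pi.single_eq_of_ne (Fin.succ_ne_zero j), add_zero] at this
      exact this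
  rw [Fin.sum_univ_succ] at hν
  omega

/-- `d` copies of `(1,0,…,0)` sum to `(d,0,…,0)`. [folklore] -/
private theorem card_nsmul_single (d : ℕ) :
    d • (Pi.single (0 : Fin (ℓ + 1)) (1 : ℕ) : Fin (ℓ + 1) → ℕ) = Pi.single 0 d := by
  funext i
  refine Fin.cases ?_ (fun j => ?_) i
  · simp
  · simp

/-- The sum of the entries of `(1,0,…,0)` is `1`. [folklore] -/
private theorem sum_single_one :
    ∑ i, (Pi.single (0 : Fin (ℓ + 1)) (1 : ℕ) : Fin (ℓ + 1) → ℕ) i = 1 := by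
  rw [Finset.sum_eq_single (0 : Fin (ℓ + 1)) (fun i _ hi => Pi.single_eq_of_ne hi _)
    (fun h => absurd (Finset.mem_univ _) h), Pi.single_eq_same]

/-- Subtracting and adding back `(1,0,…,0)` on a composition with positive first entry. [folklore] -/
private theorem sub_single_add_single {α : Fin (ℓ + 1) → ℕ} (h : 1 ≤ α 0) :
    α - Pi.single 0 1 + Pi.single 0 1 = α := by
  funext i
  refine Fin.cases ?_ (fun j => ?_) i
  · simp only [Pi.add_apply, Pi.sub_apply, Pi.single_eq_same]
    omega
  · simp

/-- Adding and subtracting `(1,0,…,0)`. [folklore] -/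
private theorem add_single_sub_single (β : Fin (ℓ + 1) → ℕ) :
    β + Pi.single 0 1 - Pi.single 0 1 = β := by
  funext i
  simp only [Pi.sub_apply, Pi.add_apply]
  omega

/-- **`c_ν(d,n)` stabilises in `n`**: for a weight `ν` of `d·n` with tail `|ν| - ν₀ ≤ n`,
`c_{ν + (d,0,…,0)}(d, n+1) = c_ν(d, n)` — adding `1` to the first entry of every composition is a
bijection (its inverse subtracts `1`, legitimate because no composition starts with `0`).
[cite: DorflerIkenmeyerPanova2020, §4, eq. (4.3) and proof of Prop. 4.5 (arXiv pp. 9–10)] -/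
theorem dipMonomialCount_add_single_right_succ (ν : Fin (ℓ + 1) → ℕ) {d n : ℕ}
    (hν : ∑ i, ν i = d * n) (ht : d * n ≤ ν 0 + n) :
    dipMonomialCount (ν + Pi.single 0 d) d (n + 1) = dipMonomialCount ν d n := by
  classical
  unfold dipMonomialCount
  have hmapback : ∀ M : Multiset (Fin (ℓ + 1) → ℕ),
      (Multiset.card M = d ∧ (∀ α ∈ M, ∑ i, α i = n + 1) ∧ M.sum = ν + Pi.single 0 d) →
      (M.map fun α => α - Pi.single 0 1).map (fun β => β + Pi.single 0 1) = M := fun M hM => by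
    rw [Multiset.map_map]
    conv_rhs => rw [← Multiset.map_id M]
    exact Multiset.map_congr rfl fun α hα => sub_single_add_single (apply_zero_pos_of_mem hν ht hM hα)
  have hsum_add : ∀ N : Multiset (Fin (ℓ + 1) → ℕ),
      (N.map fun β => β + Pi.single 0 1).sum = N.sum + Multiset.card N • Pi.single 0 1 := fun N => by
    rw [Multiset.sum_map_add, Multiset.map_id', Multiset.map_const', Multiset.sum_replicate]
  exact Nat.card_congr
    { toFun := fun M => ⟨M.1.map fun α => α - Pi.single 0 1, by
        refine ⟨by rw [Multiset.card_map, M.2.1], fun β hβ => ?_, ?_⟩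
        · obtain ⟨α, hα, rfl⟩ := Multiset.mem_map.mp hβ
          have hcancel := sub_single_add_single (apply_zero_pos_of_mem hν ht M.2 hα)
          have h1 := congrArg (fun γ : Fin (ℓ + 1) → ℕ => ∑ i, γ i) hcancel
          simp only [Pi.add_apply, Finset.sum_add_distrib, sum_single_one, M.2.2.1 α hα] at h1
          omega
        · have h := hsum_add (M.1.map fun α => α - Pi.single 0 1)
          rw [hmapback M.1 M.2, M.2.2.2, Multiset.card_map, M.2.1, card_nsmul_single] at h
          exact (add_right_cancel h).symm⟩
      invFun := fun N => ⟨N.1.map fun β => β + Pi.single 0 1, by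
        refine ⟨by rw [Multiset.card_map, N.2.1], fun α hα => ?_, by
          rw [hsum_add, N.2.2.2, N.2.1, card_nsmul_single]⟩
        obtain ⟨β, hβ, rfl⟩ := Multiset.mem_map.mp hα
        simp only [Pi.add_apply, Finset.sum_add_distrib, sum_single_one, N.2.2.1 β hβ]⟩
      left_inv := fun M => Subtype.ext (hmapback M.1 M.2)
      right_inv := fun N => Subtype.ext (by
        show (N.1.map fun β => β + Pi.single 0 1).map (fun α => α - Pi.single 0 1) = N.1
        rw [Multiset.map_map]
        conv_rhs => rw [← Multiset.map_id N.1]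
        exact Multiset.map_congr rfl fun β _ => add_single_sub_single β) }

/-- **Three rows**: `c_{(L+d, y, z)}(d, n+1) = c_{(L, y, z)}(d, n)` for `L + y + z = dn` and
`y + z ≤ n` (so `c_{(L,y,z)}(d,n)` does not depend on `n ≥ y + z` either).
[cite: DorflerIkenmeyerPanova2020, §4, eq. (4.3) and proof of Prop. 4.5 (arXiv pp. 9–10)] -/
theorem dipMonomialCount_row_stable_right_succ {n d L y z : ℕ} (hL : L + y + z = d * n)
    (hyz : y + z ≤ n) :
    dipMonomialCount ![L + d, y, z] d (n + 1) = dipMonomialCount ![L, y, z] d n := by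
  have hv : (![L + d, y, z] : Fin 3 → ℕ) = ![L, y, z] + Pi.single 0 d := by
    funext i
    fin_cases i
    · simp
    · simp [Pi.single_eq_of_ne]
    · simp [Pi.single_eq_of_ne]
  rw [hv]
  exact dipMonomialCount_add_single_right_succ ![L, y, z] (by simp [Fin.sum_univ_three]; omega)
    (by simp; omega)

end Stabilisation

/-! ### Clamping: `c_ν(d,n)` depends on `(d,n)` only through `(min d T, min n T)` for tails `≤ T` -/

section Clamp

variable {ℓ : ℕ}

/-- `(a + b, τ) = (a, τ) + (b, 0, …, 0)`. [folklore] -/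
private theorem cons_add_eq_add_single (a b : ℕ) (τ : Fin ℓ → ℕ) :
    (Fin.cons (a + b) τ : Fin (ℓ + 1) → ℕ) = Fin.cons a τ + Pi.single 0 b := by
  funext i
  refine Fin.cases ?_ (fun j => ?_) i
  · simp
  · simp

/-- The entries of `(a, τ)` sum to `a + |τ|`. [folklore] -/
private theorem sum_cons (a : ℕ) (τ : Fin ℓ → ℕ) :
    ∑ i, (Fin.cons a τ : Fin (ℓ + 1) → ℕ) i = a + ∑ j, τ j := by
  rw [Fin.sum_univ_succ]
  simp

/-- **Iterated stabilisation in `d`** (any number of rows): for a tail `τ` with `|τ| ≤ T ≤ d` and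
`n ≥ 1`, `c_{(dn-|τ|, τ)}(d,n) = c_{(Tn-|τ|, τ)}(T,n)`.
[cite: DorflerIkenmeyerPanova2020, §4, eq. (4.3) and proof of Prop. 4.5 (arXiv pp. 9–10)] -/
theorem dipMonomialCount_cons_clamp_left (τ : Fin ℓ → ℕ) {n T : ℕ} (hn : 1 ≤ n)
    (hT : ∑ j, τ j ≤ T) :
    ∀ d, T ≤ d →
      dipMonomialCount (Fin.cons (d * n - ∑ j, τ j) τ : Fin (ℓ + 1) → ℕ) d n =
        dipMonomialCount (Fin.cons (T * n - ∑ j, τ j) τ : Fin (ℓ + 1) → ℕ) T n := by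
  refine Nat.le_induction rfl fun d hd ih => ?_
  have hdn : ∑ j, τ j ≤ d * n := le_trans hT (le_trans hd (Nat.le_mul_of_pos_right d hn))
  have hsplit : (d + 1) * n - ∑ j, τ j = (d * n - ∑ j, τ j) + n := by
    rw [Nat.succ_mul]
    omega
  rw [hsplit, cons_add_eq_add_single, dipMonomialCount_add_single_succ _ hn
    (by rw [sum_cons]; omega) (by simp only [Fin.cons_zero]; omega), ih]

/-- **Iterated stabilisation in `n`** (any number of rows): for a tail `τ` with `|τ| ≤ T ≤ n` and
`d ≥ 1`, `c_{(dn-|τ|, τ)}(d,n) = c_{(dT-|τ|, τ)}(d,T)`.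
[cite: DorflerIkenmeyerPanova2020, §4, eq. (4.3) and proof of Prop. 4.5 (arXiv pp. 9–10)] -/
theorem dipMonomialCount_cons_clamp_right (τ : Fin ℓ → ℕ) {d T : ℕ} (hd : 1 ≤ d)
    (hT : ∑ j, τ j ≤ T) :
    ∀ n, T ≤ n →
      dipMonomialCount (Fin.cons (d * n - ∑ j, τ j) τ : Fin (ℓ + 1) → ℕ) d n =
        dipMonomialCount (Fin.cons (d * T - ∑ j, τ j) τ : Fin (ℓ + 1) → ℕ) d T := by
  refine Nat.le_induction rfl fun n hn ih => ?_
  have hdn : ∑ j, τ j ≤ d * n := le_trans hT (le_trans hn (Nat.le_mul_of_pos_left n hd))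
  have hsplit : d * (n + 1) - ∑ j, τ j = (d * n - ∑ j, τ j) + d := by
    rw [Nat.mul_succ]
    omega
  rw [hsplit, cons_add_eq_add_single, dipMonomialCount_add_single_right_succ _
    (by rw [sum_cons]; omega) (by simp only [Fin.cons_zero]; omega), ih]

/-- **Clamping** (any number of rows): for `n, d ≥ 1` and a tail `τ` with `|τ| ≤ T`,
`c_{(dn-|τ|, τ)}(d,n) = c_{(d'n'-|τ|, τ)}(d',n')` with `d' = min d T`, `n' = min n T` — so the finite
tail computations of Lemmas 3.7 / 3.13 via (4.4) reduce to the `T × T` box of parameters.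
[cite: DorflerIkenmeyerPanova2020, §4, eq. (4.3) and proof of Prop. 4.5 (arXiv pp. 9–10); Lemma 3.7 (p. 5), Lemma 3.13 (p. 7)] -/
theorem dipMonomialCount_cons_clamp (τ : Fin ℓ → ℕ) {n d T : ℕ} (hn : 1 ≤ n) (hd : 1 ≤ d)
    (hT1 : 1 ≤ T) (hT : ∑ j, τ j ≤ T) :
    dipMonomialCount (Fin.cons (d * n - ∑ j, τ j) τ : Fin (ℓ + 1) → ℕ) d n =
      dipMonomialCount (Fin.cons (min d T * min n T - ∑ j, τ j) τ : Fin (ℓ + 1) → ℕ)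
        (min d T) (min n T) := by
  rcases le_or_gt T d with hdT | hdT
  · rw [dipMonomialCount_cons_clamp_left τ hn hT d hdT, Nat.min_eq_right hdT]
    rcases le_or_gt T n with hnT | hnT
    · rw [dipMonomialCount_cons_clamp_right τ hT1 hT n hnT, Nat.min_eq_right hnT]
    · rw [Nat.min_eq_left hnT.le]
  · rw [Nat.min_eq_left hdT.le]
    rcases le_or_gt T n with hnT | hnT
    · rw [dipMonomialCount_cons_clamp_right τ hd hT n hnT, Nat.min_eq_right hnT]
    · rw [Nat.min_eq_left hnT.le]

end Clamp

/-! ### Clamping the whole alternating sum of (4.4) -/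

section SumClamp

variable {ℓ : ℕ}

/-- Under the guard of (4.4), the shifted row vector `λ + π - id` has the same size as `λ`.
[cite: DorflerIkenmeyerPanova2020, eq. (4.4) (arXiv p. 9)] -/
private theorem sum_shift_eq (lam : Fin (ℓ + 1) → ℕ) (π : Equiv.Perm (Fin (ℓ + 1)))
    (hg : ∀ i : Fin (ℓ + 1), (i : ℕ) ≤ lam i + (π i : ℕ)) :
    ∑ i, (lam i + (π i : ℕ) - (i : ℕ)) = ∑ i, lam i := by
  have h1 : ∑ i, (lam i + (π i : ℕ) - (i : ℕ)) + ∑ i : Fin (ℓ + 1), (i : ℕ) =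
      ∑ i, (lam i + (π i : ℕ)) := by
    rw [← Finset.sum_add_distrib]
    exact Finset.sum_congr rfl fun i _ => Nat.sub_add_cancel (hg i)
  have h2 : ∑ i : Fin (ℓ + 1), (π i : ℕ) = ∑ i : Fin (ℓ + 1), (i : ℕ) :=
    Equiv.sum_comp π (fun i : Fin (ℓ + 1) => (i : ℕ))
  rw [Finset.sum_add_distrib, h2] at h1
  omega

/-- A vector is `Fin.cons` of its head and its tail. [folklore] -/
private theorem eq_cons_tail (ν : Fin (ℓ + 1) → ℕ) :
    ν = Fin.cons (ν 0) (fun j => ν j.succ) := by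
  funext i
  refine Fin.cases ?_ (fun j => ?_) i <;> simp

/-- **Clamping the alternating sum of (4.4)** (any number of rows): for `n, d ≥ 1`, a row vector
`λ = (dn - |τ|, τ)` with tail `|τ| ≤ T` (`T ≥ 1`), the signed sum
`Σ_π sgn(π) [guard] c_{λ+π-id}(d,n)` equals the same sum for `λ' = (d'n' - |τ|, τ)` at
`(d', n') = (min d T, min n T)` — termwise, by `dipMonomialCount_cons_clamp` (each shifted vector has
tail sum `|τ| - π(0) ≤ T`). With `DIP20_eq_4_4` on the left this turns every tail computation
`a_{(dn-|τ|, τ)}(d[n]) = 0` (Lemmas 3.7, 3.13) into finitely many closed evaluations.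
[cite: DorflerIkenmeyerPanova2020, eq. (4.4) (arXiv p. 9) with Lemma 3.7 (p. 5) and Lemma 3.13 (p. 7)] -/
theorem dip44_sum_cons_clamp (τ : Fin ℓ → ℕ) {n d T : ℕ} (hn : 1 ≤ n) (hd : 1 ≤ d) (hT1 : 1 ≤ T)
    (hT : ∑ j, τ j ≤ T) (hdn : ∑ j, τ j ≤ d * n) :
    (∑ π : Equiv.Perm (Fin (ℓ + 1)), ((Equiv.Perm.sign π : ℤˣ) : ℤ) *
        (if ∀ i : Fin (ℓ + 1), (i : ℕ) ≤ (Fin.cons (d * n - ∑ j, τ j) τ : Fin (ℓ + 1) → ℕ) i + (π i : ℕ)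
          then (dipMonomialCount (fun i : Fin (ℓ + 1) =>
            (Fin.cons (d * n - ∑ j, τ j) τ : Fin (ℓ + 1) → ℕ) i + (π i : ℕ) - (i : ℕ)) d n : ℤ)
          else 0)) =
      ∑ π : Equiv.Perm (Fin (ℓ + 1)), ((Equiv.Perm.sign π : ℤˣ) : ℤ) *
        (if ∀ i : Fin (ℓ + 1), (i : ℕ) ≤
            (Fin.cons (min d T * min n T - ∑ j, τ j) τ : Fin (ℓ + 1) → ℕ) i + (π i : ℕ)
          then (dipMonomialCount (fun i : Fin (ℓ + 1) =>
            (Fin.cons (min d T * min n T - ∑ j, τ j) τ : Fin (ℓ + 1) → ℕ) i + (π i : ℕ) - (i : ℕ))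
              (min d T) (min n T) : ℤ)
          else 0) := by
  -- the clamped parameters
  have hd' : 1 ≤ min d T := le_min hd hT1
  have hn' : 1 ≤ min n T := le_min hn hT1
  have hdn' : ∑ j, τ j ≤ min d T * min n T := by
    rcases le_or_gt T d with h1 | h1
    · rw [Nat.min_eq_right h1]
      exact le_trans hT (Nat.le_mul_of_pos_right T hn')
    · rw [Nat.min_eq_left h1.le]
      rcases le_or_gt T n with h2 | h2
      · rw [Nat.min_eq_right h2]
        exact le_trans hT (Nat.le_mul_of_pos_left T hd)
      · rw [Nat.min_eq_left h2.le]
        exact hdn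
  refine Finset.sum_congr rfl fun π _ => ?_
  -- the guards agree (they differ only in the head, where both hold)
  have hguard : ∀ (a : ℕ), (∀ i : Fin (ℓ + 1), (i : ℕ) ≤ (Fin.cons a τ : Fin (ℓ + 1) → ℕ) i + (π i : ℕ)) ↔
      ∀ j : Fin ℓ, (j : ℕ) + 1 ≤ τ j + (π j.succ : ℕ) := fun a => by
    constructor
    · intro h j
      have := h j.succ
      simpa using this
    · intro h i
      refine Fin.cases (by simp) (fun j => ?_) i
      simpa using h j
  by_cases hg : ∀ j : Fin ℓ, (j : ℕ) + 1 ≤ τ j + (π j.succ : ℕ)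
  · rw [if_pos ((hguard _).mpr hg), if_pos ((hguard _).mpr hg)]
    -- both shifted vectors are `Fin.cons (DN - |τ'|) τ'` for the same tail `τ'`
    set τ' : Fin ℓ → ℕ := fun j => τ j + (π j.succ : ℕ) - ((j : ℕ) + 1) with hτ'
    have hshape : ∀ (D N : ℕ), ∑ j, τ j ≤ D * N →
        (fun i : Fin (ℓ + 1) =>
            (Fin.cons (D * N - ∑ j, τ j) τ : Fin (ℓ + 1) → ℕ) i + (π i : ℕ) - (i : ℕ)) =
          Fin.cons (D * N - ∑ j, τ' j) τ' ∧ ∑ j, τ' j ≤ ∑ j, τ j := by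
      intro D N hDN
      set f : Fin (ℓ + 1) → ℕ := fun i =>
        (Fin.cons (D * N - ∑ j, τ j) τ : Fin (ℓ + 1) → ℕ) i + (π i : ℕ) - (i : ℕ) with hf
      have htail : ∀ j : Fin ℓ, f j.succ = τ' j := fun j => by simp [hf, hτ']
      have e1 : ∑ i, f i = f 0 + ∑ j, τ' j := by
        rw [Fin.sum_univ_succ]
        exact congrArg _ (Finset.sum_congr rfl fun j _ => htail j)
      have e2 : ∑ i, f i = ∑ i, (Fin.cons (D * N - ∑ j, τ j) τ : Fin (ℓ + 1) → ℕ) i :=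
        sum_shift_eq _ π ((hguard _).mpr hg)
      have e3 := sum_cons (D * N - ∑ j, τ j) τ
      have e4 : f 0 = D * N - ∑ j, τ j + (π 0 : ℕ) := by simp [hf]
      refine ⟨?_, by omega⟩
      rw [eq_cons_tail f]
      have h0 : f 0 = D * N - ∑ j, τ' j := by omega
      rw [h0]
      exact congrArg _ (funext fun j => htail j)
    obtain ⟨hs1, hle1⟩ := hshape d n hdn
    obtain ⟨hs2, -⟩ := hshape (min d T) (min n T) hdn'
    rw [hs1, hs2, dipMonomialCount_cons_clamp τ' hn hd hT1 (le_trans hle1 hT)]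
  · rw [if_neg (fun h => hg ((hguard _).mp h)), if_neg (fun h => hg ((hguard _).mp h))]

end SumClamp

end Literature.Computability.AlgebraicComplexity
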